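import Summits.Ventures.PercRepro.C026GluingCount

/-!
# Pinned 4-terminal gluings: the merged graph and the no-mixing lemma at the pinned vertex (p6, gen 9)

mine-3's theorem M3-PINCOMP (`proofs/MINE3-Q3-proof.md` §27.14, statement sheet §27.16): for a marked
multigraph `G` and a vertex `x` other than the marks, the (C)-pinning sum `D_K(x)` and the merged sum
`Δ_{R→K}(x)` compose under gluings at the four vertices `a, b, c, x`.  The device is the graph
`G.mergeInto x a` — every endpoint `x` becomes `a`, `x` keeps no edge — whose `bot` configurations
are the configurations of `G` in which `x` lies in `K = Com_a` or in a cluster of its own, and whose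
score `[o1] + [o2] − [BAD]` is the K-view weight of §27.14 (`x`'s cluster treated as part of `K`).

* `mergeV` (the vertex map `x ↦ a`), `mergeInto`, `Conn.mergeInto` (a walk of `G` is a walk of the
  merged graph), the `bot` consequences `IsBot.not_conn_x_b` / `IsBot.not_conn_x_c`;
* `IsGluing4` — a 4-terminal gluing: every vertex other than `a, b, c, x` carries edges of ONE colour;
  **(P0)** `isGluing_mergeInto`: the merged graph of a 4-terminal gluing is a 3-terminal gluing, so
  every lemma of `C026GluingDefs`–`C026GluingCount` applies to it; **(P1)** `part_mergeInto`: merging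
  commutes with taking a part;
* **(P2)** `conn_x_iff` — the no-mixing lemma at `x`: under `bot` of the merged graph, `G` joins `x`
  to `a` iff ONE part does (a walk from `x` changes colour only at `a, b, c, x`, never meets `b, c`,
  and restarts at every return to `x`);
* `pinK` (`= D_K(x)`), `pinRK` (`= Δ_{R→K}(x)`) and the composable package `PinPackage`.

`C026Pinned.lean` proves the composition theorem `pinPackage_of_gluing4` from these.
-/

namespace PercRepro

open Classical in
/-- The vertex map of the merge `x ↦ a`: `x` goes to `a`, every other vertex is fixed. -/
noncomputable def mergeV {V : Type*} (x a v : V) : V := if v = x then a else v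

/-- The merge sends `x` to `a`. -/
@[simp] theorem mergeV_self {V : Type*} (x a : V) : mergeV x a x = a := by simp [mergeV]

/-- The merge fixes every vertex other than `x`. -/
theorem mergeV_of_ne {V : Type*} {x a v : V} (h : v ≠ x) : mergeV x a v = v := by simp [mergeV, h]

/-- The merge fixes `a` (whether or not `a = x`). -/
@[simp] theorem mergeV_target {V : Type*} (x a : V) : mergeV x a a = a := by
  unfold mergeV
  split_ifs <;> rfl

/-- The merge never produces `x` when `x ≠ a`. -/
theorem mergeV_ne {V : Type*} {x a : V} (hxa : x ≠ a) (v : V) : mergeV x a v ≠ x := by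
  unfold mergeV
  split_ifs with h
  · exact hxa.symm
  · exact h

/-- For a vertex `v` other than `a` and `x`, `mergeV x a u = v` iff `u = v`. -/
theorem mergeV_eq_iff {V : Type*} {x a v : V} (hva : v ≠ a) (hvx : v ≠ x) (u : V) :
    mergeV x a u = v ↔ u = v := by
  unfold mergeV
  split_ifs with h
  · exact ⟨fun h' => absurd h'.symm hva, fun h' => absurd (h'.symm.trans h) hvx⟩
  · exact Iff.rfl

namespace MultiGraph

section Pinned

variable {V E : Type*}

open Classical in
/-- **`x` merged into `a`**: every endpoint `x` becomes `a` (same edge type; `x` keeps no edge).  This is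
the graph `G/xa` of §27.14, in which `x`'s cluster is part of `K = Com_a`. -/
noncomputable def mergeInto (G : MultiGraph V E) (x a : V) : MultiGraph V E :=
  ⟨fun e => if G.fst e = x then a else G.fst e, fun e => if G.snd e = x then a else G.snd e⟩

variable (G : MultiGraph V E)

/-- The first endpoint in the merged graph. -/
theorem mergeInto_fst (x a : V) (e : E) : (G.mergeInto x a).fst e = mergeV x a (G.fst e) := rfl

/-- The second endpoint in the merged graph. -/
theorem mergeInto_snd (x a : V) (e : E) : (G.mergeInto x a).snd e = mergeV x a (G.snd e) := rfl

/-- **(P1)** Merging commutes with taking a part. -/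
theorem part_mergeInto (x a : V) (side : E → Bool) (s : Bool) :
    (G.part side s).mergeInto x a = (G.mergeInto x a).part side s := rfl

/-- `x` carries no edge of the merged graph (when `x ≠ a`). -/
theorem not_edgeAt_mergeInto {x a : V} (hxa : x ≠ a) (e : E) : ¬ (G.mergeInto x a).EdgeAt e x := by
  unfold EdgeAt
  rw [mergeInto_fst, mergeInto_snd]
  rintro (h | h)
  · exact mergeV_ne hxa _ h
  · exact mergeV_ne hxa _ h

/-- At a vertex other than `a` and `x`, the edges of the merged graph are those of `G`. -/
theorem edgeAt_mergeInto_iff {x a v : V} (hva : v ≠ a) (hvx : v ≠ x) (e : E) :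
    (G.mergeInto x a).EdgeAt e v ↔ G.EdgeAt e v := by
  unfold EdgeAt
  rw [mergeInto_fst, mergeInto_snd, mergeV_eq_iff hva hvx, mergeV_eq_iff hva hvx]

variable {G}

/-- An open step of `G` is an open step of the merged graph between the merged endpoints. -/
theorem OpenAdj.mergeInto {ω : Config E} {u v : V} (h : G.OpenAdj ω u v) (x a : V) :
    (G.mergeInto x a).OpenAdj ω (mergeV x a u) (mergeV x a v) := by
  obtain ⟨e, he, hend⟩ := h
  refine ⟨e, he, ?_⟩
  rw [mergeInto_fst, mergeInto_snd]
  rcases hend with ⟨h1, h2⟩ | ⟨h1, h2⟩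
  · exact Or.inl ⟨by rw [h1], by rw [h2]⟩
  · exact Or.inr ⟨by rw [h1], by rw [h2]⟩

/-- **A walk of `G` is a walk of the merged graph** between the merged endpoints. -/
theorem Conn.mergeInto {ω : Config E} {u v : V} (h : G.Conn ω u v) (x a : V) :
    (G.mergeInto x a).Conn ω (mergeV x a u) (mergeV x a v) := by
  unfold Conn at h ⊢
  induction h with
  | refl => exact Relation.ReflTransGen.refl
  | tail _ hxy ih => exact ih.tail (OpenAdj.mergeInto hxy x a)

/-- Under `bot` of the merged graph, `x` is not joined to `b` in `G`. -/
theorem IsBot.not_conn_x_b {ω : Config E} {a b c x : V} (hb : (G.mergeInto x a).IsBot ω a b c)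
    (hxb : x ≠ b) : ¬ G.Conn ω x b := fun h => by
  have h' := h.mergeInto x a
  rw [mergeV_self, mergeV_of_ne hxb.symm] at h'
  exact hb.1 h'

/-- Under `bot` of the merged graph, `x` is not joined to `c` in `G`. -/
theorem IsBot.not_conn_x_c {ω : Config E} {a b c x : V} (hb : (G.mergeInto x a).IsBot ω a b c)
    (hxc : x ≠ c) : ¬ G.Conn ω x c := fun h => by
  have h' := h.mergeInto x a
  rw [mergeV_self, mergeV_of_ne hxc.symm] at h'
  exact hb.2.1 h'

/-- Under `bot` of the merged graph, `G` itself is `bot` (when `b ≠ x` and `c ≠ x`). -/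
theorem IsBot.of_mergeInto {ω : Config E} {a b c x : V} (hb : (G.mergeInto x a).IsBot ω a b c)
    (hxb : x ≠ b) (hxc : x ≠ c) : G.IsBot ω a b c := by
  refine ⟨fun h => hb.1 ?_, fun h => hb.2.1 ?_, fun h => hb.2.2 ?_⟩
  · have h' := h.mergeInto x a
    rwa [mergeV_target, mergeV_of_ne hxb.symm] at h'
  · have h' := h.mergeInto x a
    rwa [mergeV_target, mergeV_of_ne hxc.symm] at h'
  · have h' := h.mergeInto x a
    rwa [mergeV_of_ne hxb.symm, mergeV_of_ne hxc.symm] at h'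

variable (G)

/-- **A 4-terminal gluing**: the edges are two-coloured by `side`, and every vertex other than
`a, b, c, x` is incident to edges of one colour only (`x` itself may carry both colours). -/
def IsGluing4 (a b c x : V) (side : E → Bool) : Prop :=
  ∀ v, v ≠ a → v ≠ b → v ≠ c → v ≠ x → ∀ e e', G.EdgeAt e v → G.EdgeAt e' v → side e = side e'

/-- `IsGluing4` is decidable on finite types, so concrete 4-terminal gluings are instances by `decide`. -/
instance decidableIsGluing4 [Fintype V] [Fintype E] [DecidableEq V] (a b c x : V) (side : E → Bool) :
    Decidable (G.IsGluing4 a b c x side) := by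
  unfold IsGluing4 EdgeAt
  infer_instance

variable {G}

/-- **A non-terminal has one colour** (`HasCol` form). -/
theorem IsGluing4.eq_of_hasCol {a b c x : V} {side : E → Bool} (hg : G.IsGluing4 a b c x side)
    {v : V} (hva : v ≠ a) (hvb : v ≠ b) (hvc : v ≠ c) (hvx : v ≠ x) {s s' : Bool}
    (hs : G.HasCol side s v) (hs' : G.HasCol side s' v) : s = s' := by
  obtain ⟨e, rfl, he⟩ := hs
  obtain ⟨e', rfl, he'⟩ := hs'
  exact hg v hva hvb hvc hvx e e' he he'

/-- A 3-terminal gluing is a 4-terminal gluing at any fourth vertex. -/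
theorem IsGluing.isGluing4 {a b c : V} {side : E → Bool} (hg : G.IsGluing a b c side) (x : V) :
    G.IsGluing4 a b c x side :=
  fun v hva hvb hvc _ e e' he he' => hg v hva hvb hvc e e' he he'

/-- **(P0)** The merged graph of a 4-terminal gluing is a 3-terminal gluing: every vertex other than
`a, b, c` and `x` keeps its one colour, and `x` has no edge left. -/
theorem isGluing_mergeInto {a b c x : V} {side : E → Bool} (hxa : x ≠ a)
    (hg : G.IsGluing4 a b c x side) : (G.mergeInto x a).IsGluing a b c side := by
  intro v hva hvb hvc e e' he he'
  by_cases hvx : v = x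
  · subst hvx
    exact absurd he (G.not_edgeAt_mergeInto hxa e)
  · exact hg v hva hvb hvc hvx e e' ((G.edgeAt_mergeInto_iff hva hvx e).mp he)
      ((G.edgeAt_mergeInto_iff hva hvx e').mp he')

/-- **(P2) The no-mixing lemma at the pinned vertex.** Under `bot` of the merged graph, `G` joins `x`
to `a` iff one of the two parts does: along a walk from `x` every vertex other than `a` and `x` is a
non-terminal of one colour (the walk never meets `b` or `c`), so the walk is one-coloured from its last
visit of `x` to its first visit of `a`. -/
theorem conn_x_iff {a b c x : V} {side : E → Bool} (hg : G.IsGluing4 a b c x side) (hxb : x ≠ b)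
    (hxc : x ≠ c) {ω : Config E} (hb : (G.mergeInto x a).IsBot ω a b c) :
    G.Conn ω x a ↔
      (G.part side true).Conn (sideRestrict ω side true) x a ∨
        (G.part side false).Conn (sideRestrict ω side false) x a := by
  constructor
  · intro h
    have hxb' : ¬ G.Conn ω x b := hb.not_conn_x_b hxb
    have hxc' : ¬ G.Conn ω x c := hb.not_conn_x_c hxc
    -- invariant along the walk from `x`: either `a` is already reached by a one-coloured walk, or the
    -- current vertex is reached from `x` by a one-coloured walk
    have key : (∃ s, (G.part side s).Conn (sideRestrict ω side s) x a) ∨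
        (∃ s, (G.part side s).Conn (sideRestrict ω side s) x a) := by
      refine Conn.induction
        (motive := fun v => (∃ s, (G.part side s).Conn (sideRestrict ω side s) x a) ∨
          (∃ s, (G.part side s).Conn (sideRestrict ω side s) x v))
        (Or.inr ⟨true, Conn.refl _ _ _⟩) ?_ h
      intro v w hxv hvw ih
      rcases ih with ih | ⟨s, hs⟩
      · exact Or.inl ih
      obtain ⟨e, he, hend⟩ := hvw
      have hj : G.Joins e v w := hend
      by_cases hva : v = a
      · exact Or.inl ⟨s, hva ▸ hs⟩
      by_cases hvx : v = x
      · rw [hvx] at hj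
        exact Or.inr ⟨side e, Conn.of_openAdj (openAdj_part_of_open he hj)⟩
      -- `v` is a non-terminal of the colour `s` of the walk reaching it
      have hvb : v ≠ b := fun h' => hxb' (h' ▸ hxv)
      have hvc : v ≠ c := fun h' => hxc' (h' ▸ hxv)
      have hcol : side e = s :=
        hg.eq_of_hasCol hva hvb hvc hvx (HasCol.of_joins (side := side) hj).1
          (hasCol_of_conn_part hs hvx)
      exact Or.inr ⟨s, hs.tail ⟨⟨e, hcol⟩, he, hj⟩⟩
    rcases key with ⟨s, hs⟩ | ⟨s, hs⟩ <;> cases s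
    · exact Or.inr hs
    · exact Or.inl hs
    · exact Or.inr hs
    · exact Or.inl hs
  · rintro (h | h) <;> exact Conn.of_part h

variable (G)

open Classical in
/-- **`D_K(x)`**, the (C)-pinning sum of §23.1: the total score of the merged graph over the `bot`
configurations in which `x` lies in `K = Com_a`. -/
noncomputable def pinK [Fintype E] [DecidableEq E] (a b c x : V) : ℤ :=
  ∑ ω : Config E, if (G.mergeInto x a).IsBot ω a b c ∧ G.Conn ω x a then
    (G.mergeInto x a).hScore ω a b c else 0

open Classical in
/-- **`Δ_{R→K}(x)`**: the total score of the merged graph over the `bot` configurations in which `x`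
is NOT joined to `a` (its cluster is merged into `K`). -/
noncomputable def pinRK [Fintype E] [DecidableEq E] (a b c x : V) : ℤ :=
  ∑ ω : Config E, if (G.mergeInto x a).IsBot ω a b c ∧ ¬ G.Conn ω x a then
    (G.mergeInto x a).hScore ω a b c else 0

/-- **The composable package `P(x)`** of §27.14: `D_K(x) ≥ 0` and `Δ_{R→K}(x) ≥ 0`. -/
def PinPackage [Fintype E] [DecidableEq E] (a b c x : V) : Prop :=
  0 ≤ G.pinK a b c x ∧ 0 ≤ G.pinRK a b c x

end Pinned

end MultiGraph

end PercRepro
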